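import Summits.Ventures.PercRepro.S1CoreCapEightFourNT

/-!
# PercRepro — TOWARDS `Q*(8)`: FOUR BIG LINES WITHOUT A TRIANGLE — THE VERTEX LEMMA (p1, gen 27)

The second third of the no-triangle half of `FourBigBound₈`. From the eight facts of `meets_all_of_meet`
(`|B ∩ A| = |D ∩ C| = 1`, each of `C, D` meets `A ∪ B` once, each of `A, B` meets `C ∪ D` once, `X` meets every
big line once): the vertex `p` of `A, B` lies on neither `C` nor `D` (`vertex_not_mem`: if `p ∈ C` then
`A ∩ D ⊆ {p}`, and either all four lines pass through `p` — then `X`, meeting all four lines in one point each,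
is the single point `p` or has four distinct points — or `D ∌ p`, `A ∩ D = ∅`, `D` meets `B` elsewhere and
`B, C, D` form a triangle). By symmetry `q ∉ A ∪ B`, so the meeting graph is a 4-cycle
(`proofs/P1-S4-CAPBRIDGE.md` §19 ADDENDUM 2; the cycle and the final orderings are the last third, not typed).
Axioms: standard.
-/

namespace PercRepro

namespace S1

namespace FourCap

namespace Eight

open Seven

variable {β : Type} [DecidableEq β]

/-- Inclusion–exclusion for an intersection with a union: `|M ∩ (N ∪ O)| + |M ∩ N ∩ O| = |M ∩ N| + |M ∩ O|`. -/
theorem card_inter_union_add (M N O : Finset β) :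
    (M ∩ (N ∪ O)).card + (M ∩ N ∩ O).card = (M ∩ N).card + (M ∩ O).card := by
  have := Finset.card_union_add_card_inter (M ∩ N) (M ∩ O)
  rw [← Finset.inter_union_distrib_left] at this
  have e : M ∩ N ∩ (M ∩ O) = M ∩ N ∩ O := by
    ext v
    simp only [Finset.mem_inter]
    tauto
  rw [e] at this
  exact this

omit [DecidableEq β] in
/-- A subset of a set of at most one point with at least one point is the whole set. -/
theorem eq_of_subset_of_card_le_one {P S : Finset β} (h : P ⊆ S) (hS : S.card ≤ 1) (hP : 1 ≤ P.card) :
    P = S :=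
  Finset.eq_of_subset_of_card_le h (by omega)

section Vertex

variable {w : β → ℕ} {ls : Finset (Finset β)}
  (h3 : ∀ L ∈ ls, ∀ L' ∈ ls, L ≠ L' → (L ∩ L').card ≤ 1)

include h3 in
/-- **The vertex of `A, B` is not on `C`**, given the eight facts, `NoTriangle` and `X ⊆ A ∪ B ∪ C ∪ D`. -/
theorem vertex_not_mem (hnt : NoTriangle ls) {X A B C D : Finset β} (hX : X ∈ ls) (hA : A ∈ ls)
    (hB : B ∈ ls) (hC : C ∈ ls) (hD : D ∈ ls) (hAX : A ≠ X) (hBX : B ≠ X) (hCX : C ≠ X) (hDX : D ≠ X)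
    (hBA : B ≠ A) (hCA : C ≠ A) (hDA : D ≠ A) (hCB : C ≠ B) (hDB : D ≠ B) (hDC : D ≠ C)
    (cX : X.card = 3) (cA : 4 ≤ A.card) (cB : 4 ≤ B.card) (cC : 4 ≤ C.card) (cD : 4 ≤ D.card)
    (hXsub : X ⊆ D ∪ (C ∪ (B ∪ A)))
    (eBA : (B ∩ A).card = 1) (eDC : (D ∩ C).card = 1) (eC : (C ∩ (B ∪ A)).card = 1)
    (eD : (D ∩ (B ∪ A)).card = 1) (eA : (A ∩ (D ∪ C)).card = 1) (eB : (B ∩ (D ∪ C)).card = 1)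
    (xA : (X ∩ A).card = 1) (xB : (X ∩ B).card = 1) (xC : (X ∩ C).card = 1) (xD : (X ∩ D).card = 1) :
    (C ∩ B ∩ A).card = 0 := by
  by_contra hne
  have hp : 1 ≤ (C ∩ B ∩ A).card := Nat.one_le_iff_ne_zero.2 hne
  set P := C ∩ B ∩ A with hP
  have hPA : P ⊆ A := Finset.inter_subset_right
  have hPB : P ⊆ B := Finset.inter_subset_left.trans Finset.inter_subset_right
  have hPC : P ⊆ C := Finset.inter_subset_left.trans Finset.inter_subset_left
  -- pairwise bounds
  have pCA := h3 C hC A hA hCA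
  have pCB := h3 C hC B hB hCB
  have pDA := h3 D hD A hA hDA
  have pDB := h3 D hD B hB hDB
  have pXM : ∀ M, M ∈ ls → M ≠ X → (X ∩ M).card ≤ 1 := fun M hM hMX => h3 X hX M hM hMX.symm
  -- `B ∩ A = C ∩ A = C ∩ B = P`
  have eqBA : P = B ∩ A := eq_of_subset_of_card_le_one (fun v hv => Finset.mem_inter.2 ⟨hPB hv, hPA hv⟩)
    eBA.le hp
  have eqCA : P = C ∩ A := eq_of_subset_of_card_le_one (fun v hv => Finset.mem_inter.2 ⟨hPC hv, hPA hv⟩)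
    pCA hp
  have eqCB : P = C ∩ B := eq_of_subset_of_card_le_one (fun v hv => Finset.mem_inter.2 ⟨hPC hv, hPB hv⟩)
    pCB hp
  have hP1 : P.card = 1 := by rw [eqBA]; exact eBA
  have cCA : (C ∩ A).card = 1 := by rw [← eqCA]; exact hP1
  have cCB : (C ∩ B).card = 1 := by rw [← eqCB]; exact hP1
  -- `A ∩ D ⊆ A ∩ C = P`: `|A ∩ D| = |A ∩ D ∩ C|`
  have uA := card_inter_union_add A D C
  have iAC : (A ∩ C).card = (C ∩ A).card := by rw [Finset.inter_comm]
  have hAD : (A ∩ D).card = (A ∩ D ∩ C).card := by omega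
  by_cases hpD : 1 ≤ (A ∩ D ∩ C).card
  · -- all four lines pass through `p`: every pairwise intersection is `P`
    have hPD : P ⊆ D := by
      have e : A ∩ D ∩ C = C ∩ A := eq_of_subset_of_card_le_one (fun v hv => Finset.mem_inter.2
        ⟨(Finset.mem_inter.1 hv).2, (Finset.mem_inter.1 (Finset.mem_inter.1 hv).1).1⟩) pCA hpD
      intro v hv
      have hv' : v ∈ C ∩ A := by rw [← eqCA]; exact hv
      rw [← e] at hv'
      exact (Finset.mem_inter.1 (Finset.mem_inter.1 hv').1).2
    have eqDA : P = D ∩ A := eq_of_subset_of_card_le_one (fun v hv => Finset.mem_inter.2 ⟨hPD hv, hPA hv⟩)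
      pDA hp
    have eqDB : P = D ∩ B := eq_of_subset_of_card_le_one (fun v hv => Finset.mem_inter.2 ⟨hPD hv, hPB hv⟩)
      pDB hp
    have eqDC : P = D ∩ C := eq_of_subset_of_card_le_one (fun v hv => Finset.mem_inter.2 ⟨hPD hv, hPC hv⟩)
      eDC.le hp
    -- two big lines meet only inside `P`
    have meetP : ∀ v, v ∈ X → ∀ M N : Finset β, (M = A ∨ M = B ∨ M = C ∨ M = D) →
        (N = A ∨ N = B ∨ N = C ∨ N = D) → M ≠ N → v ∈ M → v ∈ N → v ∈ P := by
      intro v _ M N hM hN hMN hvM hvN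
      rcases hM with rfl | rfl | rfl | rfl <;> rcases hN with rfl | rfl | rfl | rfl <;>
        first
        | exact absurd rfl hMN
        | (rw [eqBA]; exact Finset.mem_inter.2 ⟨hvN, hvM⟩)
        | (rw [eqBA]; exact Finset.mem_inter.2 ⟨hvM, hvN⟩)
        | (rw [eqCA]; exact Finset.mem_inter.2 ⟨hvN, hvM⟩)
        | (rw [eqCA]; exact Finset.mem_inter.2 ⟨hvM, hvN⟩)
        | (rw [eqCB]; exact Finset.mem_inter.2 ⟨hvN, hvM⟩)
        | (rw [eqCB]; exact Finset.mem_inter.2 ⟨hvM, hvN⟩)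
        | (rw [eqDA]; exact Finset.mem_inter.2 ⟨hvN, hvM⟩)
        | (rw [eqDA]; exact Finset.mem_inter.2 ⟨hvM, hvN⟩)
        | (rw [eqDB]; exact Finset.mem_inter.2 ⟨hvN, hvM⟩)
        | (rw [eqDB]; exact Finset.mem_inter.2 ⟨hvM, hvN⟩)
        | (rw [eqDC]; exact Finset.mem_inter.2 ⟨hvN, hvM⟩)
        | (rw [eqDC]; exact Finset.mem_inter.2 ⟨hvM, hvN⟩)
    by_cases hpX : P ⊆ X
    · -- `X ∩ M = P` for every big `M`, so `X ⊆ P`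
      have hXM : ∀ M, M ∈ ls → M ≠ X → (X ∩ M).card = 1 → P ⊆ M → X ∩ M = P := fun M hM hMX h1 hPM =>
        (eq_of_subset_of_card_le_one (fun v hv => Finset.mem_inter.2 ⟨hpX hv, hPM hv⟩) h1.le hp).symm
      have hXP : X ⊆ P := by
        intro v hv
        have hv' := hXsub hv
        rcases Finset.mem_union.1 hv' with h | h
        · rw [← hXM D hD hDX xD hPD]; exact Finset.mem_inter.2 ⟨hv, h⟩
        rcases Finset.mem_union.1 h with h | h
        · rw [← hXM C hC hCX xC hPC]; exact Finset.mem_inter.2 ⟨hv, h⟩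
        rcases Finset.mem_union.1 h with h | h
        · rw [← hXM B hB hBX xB hPB]; exact Finset.mem_inter.2 ⟨hv, h⟩
        · rw [← hXM A hA hAX xA hPA]; exact Finset.mem_inter.2 ⟨hv, h⟩
      have := Finset.card_le_card hXP
      have hP1 : P.card ≤ 1 := by rw [eqBA]; exact eBA.le
      omega
    · -- `p ∉ X`: the four sets `X ∩ M` are pairwise disjoint, so `X` has four points
      have hpX' : ∀ v, v ∈ X → v ∉ P := by
        intro v hv hvP
        apply hpX
        intro u hu
        -- `P` is a single point: `u = v`
        have hP1 : P.card ≤ 1 := by rw [eqBA]; exact eBA.le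
        have : u = v := by
          have hsub : ({u, v} : Finset β) ⊆ P := by
            intro x hx
            simp only [Finset.mem_insert, Finset.mem_singleton] at hx
            rcases hx with rfl | rfl
            · exact hu
            · exact hvP
          by_contra hne'
          have := Finset.card_le_card hsub
          rw [Finset.card_pair hne'] at this
          omega
        rw [this]; exact hv
      have disj : ∀ M N : Finset β, (M = A ∨ M = B ∨ M = C ∨ M = D) → (N = A ∨ N = B ∨ N = C ∨ N = D) →
          M ≠ N → Disjoint (X ∩ M) (X ∩ N) := by
        intro M N hM hN hMN
        rw [Finset.disjoint_left]
        intro v hv1 hv2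
        exact hpX' v (Finset.mem_inter.1 hv1).1 (meetP v (Finset.mem_inter.1 hv1).1 M N hM hN hMN
          (Finset.mem_inter.1 hv1).2 (Finset.mem_inter.1 hv2).2)
      have u1 : (X ∩ (A ∪ B)).card = 2 := by
        rw [Finset.inter_union_distrib_left, Finset.card_union_of_disjoint (disj A B (by simp) (by simp) hBA.symm)]
        omega
      have u2 : (X ∩ (A ∪ B ∪ C)).card = 3 := by
        rw [Finset.inter_union_distrib_left (s := X) (t := A ∪ B) (u := C)]
        rw [Finset.card_union_of_disjoint]
        · omega
        · rw [Finset.inter_union_distrib_left, Finset.disjoint_union_left]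
          exact ⟨disj A C (by simp) (by simp) hCA.symm, disj B C (by simp) (by simp) hCB.symm⟩
      have u3 : (X ∩ (A ∪ B ∪ C ∪ D)).card = 4 := by
        rw [Finset.inter_union_distrib_left (s := X) (t := A ∪ B ∪ C) (u := D)]
        rw [Finset.card_union_of_disjoint]
        · omega
        · rw [Finset.inter_union_distrib_left, Finset.inter_union_distrib_left, Finset.disjoint_union_left,
            Finset.disjoint_union_left]
          exact ⟨⟨disj A D (by simp) (by simp) hDA.symm, disj B D (by simp) (by simp) hDB.symm⟩,
            disj C D (by simp) (by simp) hDC.symm⟩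
      have hXe : X ∩ (A ∪ B ∪ C ∪ D) = X := by
        apply Finset.inter_eq_left.2
        intro v hv
        have := hXsub hv
        simp only [Finset.mem_union] at this ⊢
        tauto
      rw [hXe] at u3
      omega
  · -- `A ∩ D = ∅`: `D` meets `B` away from `p`, and `B, C, D` is a triangle
    have cAD : (A ∩ D).card = 0 := by omega
    have cDA : (D ∩ A).card = 0 := by rw [Finset.inter_comm]; exact cAD
    have uD := card_inter_union_add D B A
    have cDB : (D ∩ B).card = 1 := by
      have : (D ∩ B ∩ A).card ≤ (D ∩ A).card := Finset.card_le_card (fun v hv => Finset.mem_inter.2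
        ⟨(Finset.mem_inter.1 (Finset.mem_inter.1 hv).1).1, (Finset.mem_inter.1 hv).2⟩)
      omega
    -- no triangle on `(B, C, D)`: `|C ∩ B| = 1`, so `|D ∩ (C ∪ B)| ≤ 1`
    have tD : (D ∩ (C ∪ B)).card ≤ 1 := by
      rcases hnt B C D hB hC hD cB cC cD hCB hDB hDC with h | h
      · omega
      · exact h
    have uD' := card_inter_union_add D C B
    -- `D ∩ C ∩ B ⊆ D ∩ P ⊆ D ∩ A = ∅`
    have hz : (D ∩ C ∩ B).card = 0 := by
      rw [Finset.card_eq_zero, Finset.eq_empty_iff_forall_notMem]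
      intro v hv
      have h1' := Finset.mem_inter.1 hv
      have h2' := Finset.mem_inter.1 h1'.1
      have hcb : v ∈ C ∩ B := Finset.mem_inter.2 ⟨h2'.2, h1'.2⟩
      rw [← eqCB] at hcb
      have hda : v ∈ D ∩ A := Finset.mem_inter.2 ⟨h2'.1, hPA hcb⟩
      have := Finset.card_pos.2 ⟨v, hda⟩
      omega
    omega

end Vertex

end Eight

end FourCap

end S1

end PercRepro
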